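import Mathlib
import Literature.Analysis.Convexity.BrunnMinkowski
import Summits.Ventures.Crystal3D.Theorems.StickyWulffConstantStackingLiminfStackVolume
import Summits.Ventures.Crystal3D.Theorems.StickyWulffConstantStackingLiminfSliceDomination
import HarnessLib

/-!
# Chimera Brunn–Minkowski for the stacking Wulff bodies `W_f` (line `LayerChain`, stub `chimera`,
# crux `StackingLiminf`, stmt-Ventures-19145): every layered profile's chimera neighbourhood is at
# least as large as the fcc one

Route `StickyWulffConstant` of the venture `Summits/Ventures/Crystal3D` (cell `crystal3d-full`).
In the coordinates of `StickyWulffConstantLayerChainDefs` (bodies in `Fin 3 → ℝ`, height = last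
coordinate, horizontal sections `{p : ℝ × ℝ | (p.1, p.2, y) ∈ ·}` as in `stackSlice`):
* `chimera3_volume_rpow_mul_le` / `chimera3_brunnMinkowski_pow` / `chimera3_brunnMinkowski` — the
  Brunn–Minkowski inequality with a HEIGHT-DEPENDENT summand `W t` whose sections dominate those of a
  reference body `W₀`: if `C ⊇ {a + w | a ∈ A, w ∈ W(a₂)}` then `|C|^{1/3} ≥ |A|^{1/3} + |W₀|^{1/3}`
  (slice proof of Brunn–Minkowski: the tree's planar multiplicative Brunn–Minkowski — transferred to
  `ℝ × ℝ` in `volume_rpow_mul_volume_rpow_le_real2` — the tree's Prékopa–Leindler inequality on the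
  line, and Cavalieri `volume_eq_lintegral_slice3`; only the section AREAS of the summand enter).
* **`chimera_stackWulff`** — for EVERY height profile `f : ℝ → [0, 1]`, every measurable `A` and
  `r > 0`: if `C ⊇ {a + r•w | a ∈ A, w ∈ W_{f(a₂)}}` then
  `|A|^{1/3} + r·|W_0|^{1/3} ≤ |C|^{1/3}`, `|W_0| = 64√2` (`volume_stackWulff_zero`) — by the landed
  `stub_sliceDomination` (p476944: `|stackSlice 0 y| ≤ |stackSlice f y|`).  This is the volume
  (Minkowski-content) form of the chimera step (b) of `Lines/LayerChain.md`: the `r`-neighbourhood of a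
  layered set built with the LOCAL stacking Wulff body `W_{f(z)}` at each height is never smaller than
  the fcc prediction `(|A|^{1/3} + r|W_0|^{1/3})³`, whatever the profile (no measurability, no
  stationarity of `f`), without Knothe-map regularity.
WHAT THIS IS NOT: not the Γ-liminf / blow-up half of stub `chimera`, not a perimeter statement, not
`SymChainBound`; nothing discrete; rung F-C1 not moved.
-/

noncomputable section

namespace Summit.Ventures.Crystal3D.Theorems.Chimera

open MeasureTheory Set
open Summit.Ventures.Crystal3D.LayerChain (stackWulff stackSlice)
open Summit.Ventures.Crystal3D.Theorems (volume_eq_lintegral_slice3 measurableSet_stackWulff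
  stub_sliceDomination volume_stackWulff_zero)
open Literature.Analysis.Convexity (volume_rpow_mul_volume_rpow_le prekopaLeindler_real)
open scoped ENNReal Pointwise

/-! ### Planar multiplicative Brunn–Minkowski on `ℝ × ℝ` -/

/-- The tree's multiplicative Brunn–Minkowski inequality (`EuclideanSpace ℝ (Fin 2)`) transferred to
`ℝ × ℝ`: `(1−s)A + sB ⊆ C ⇒ |A|^{1−s}|B|^s ≤ |C|`. -/
theorem volume_rpow_mul_volume_rpow_le_real2 {s : ℝ} (hs0 : 0 < s) (hs1 : s < 1)
    {A B C : Set (ℝ × ℝ)} (hA : MeasurableSet A) (hB : MeasurableSet B) (hC : MeasurableSet C)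
    (hsub : (1 - s) • A + s • B ⊆ C) :
    volume A ^ (1 - s) * volume B ^ s ≤ volume C := by
  set T : EuclideanSpace ℝ (Fin 2) ≃ᵐ ℝ × ℝ :=
    (MeasurableEquiv.toLp 2 (Fin 2 → ℝ)).symm.trans MeasurableEquiv.finTwoArrow with hT
  have hTmp : MeasurePreserving T volume volume :=
    (EuclideanSpace.volume_preserving_symm_measurableEquiv_toLp (Fin 2)).trans
      (volume_preserving_finTwoArrow ℝ)
  have happly : ∀ x : EuclideanSpace ℝ (Fin 2), T x = (x 0, x 1) := fun x => rfl
  have hTlin : ∀ (c d : ℝ) (x y : EuclideanSpace ℝ (Fin 2)), T (c • x + d • y) = c • T x + d • T y := by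
    intro c d x y
    rw [happly, happly, happly]
    rfl
  have hA' : volume (T ⁻¹' A) = volume A := hTmp.measure_preimage hA.nullMeasurableSet
  have hB' : volume (T ⁻¹' B) = volume B := hTmp.measure_preimage hB.nullMeasurableSet
  have hC' : volume (T ⁻¹' C) = volume C := hTmp.measure_preimage hC.nullMeasurableSet
  have hsub' : (1 - s) • (T ⁻¹' A) + s • (T ⁻¹' B) ⊆ T ⁻¹' C := by
    intro z hz
    obtain ⟨_, ⟨x, hx, rfl⟩, _, ⟨y, hy, rfl⟩, rfl⟩ := hz
    rw [mem_preimage, hTlin]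
    exact hsub (Set.add_mem_add (Set.smul_mem_smul_set hx) (Set.smul_mem_smul_set hy))
  have h := volume_rpow_mul_volume_rpow_le hs0 hs1 (hA.preimage T.measurable)
    (hB.preimage T.measurable) (hC.preimage T.measurable) hsub'
  rwa [hA', hB', hC'] at h

/-! ### Horizontal sections in `Fin 3 → ℝ` -/

/-- The section map `p ↦ (p.1, p.2, y)` is measurable. -/
theorem measurable_vec3 (y : ℝ) : Measurable fun p : ℝ × ℝ => (![p.1, p.2, y] : Fin 3 → ℝ) := by
  refine measurable_pi_lambda _ fun i => ?_
  fin_cases i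
  · simpa using measurable_fst
  · simpa using measurable_snd
  · simp

/-- Sections of measurable sets are measurable. -/
theorem measurableSet_slice3 {S : Set (Fin 3 → ℝ)} (hS : MeasurableSet S) (y : ℝ) :
    MeasurableSet {p : ℝ × ℝ | (![p.1, p.2, y] : Fin 3 → ℝ) ∈ S} :=
  hS.preimage (measurable_vec3 y)

/-- The section `{p | (p.1,p.2,y) ∈ S}` as an iterated preimage through `Fin 3 → ℝ ≃ ℝ × (Fin 2 → ℝ)`. -/
theorem slice3_eq_preimage (S : Set (Fin 3 → ℝ)) (y : ℝ) :
    {p : ℝ × ℝ | (![p.1, p.2, y] : Fin 3 → ℝ) ∈ S} =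
      (MeasurableEquiv.finTwoArrow (α := ℝ)).symm ⁻¹'
        (Prod.mk y ⁻¹' ((MeasurableEquiv.piFinSuccAbove (fun _ : Fin 3 => ℝ) 2).symm ⁻¹' S)) := by
  ext p
  simp only [mem_setOf_eq, mem_preimage]
  have : (MeasurableEquiv.piFinSuccAbove (fun _ : Fin 3 => ℝ) 2).symm
      (y, (MeasurableEquiv.finTwoArrow (α := ℝ)).symm p) = ![p.1, p.2, y] := by
    have e0 : (0 : Fin 3) = (2 : Fin 3).succAbove 0 := by decide
    have e1 : (1 : Fin 3) = (2 : Fin 3).succAbove 1 := by decide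
    ext i
    fin_cases i
    · simp only [MeasurableEquiv.piFinSuccAbove_symm_apply, Fin.insertNthEquiv,
        MeasurableEquiv.finTwoArrow]
      simp
      rw [e0, Fin.insertNth_apply_succAbove]; simp
    · simp only [MeasurableEquiv.piFinSuccAbove_symm_apply, Fin.insertNthEquiv,
        MeasurableEquiv.finTwoArrow]
      simp
      rw [e1, Fin.insertNth_apply_succAbove]; simp
    · simp [MeasurableEquiv.piFinSuccAbove_symm_apply, Fin.insertNthEquiv,
        MeasurableEquiv.finTwoArrow]
  rw [this]

/-- The section-area function of a measurable set is measurable. -/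
theorem measurable_volume_slice3 {S : Set (Fin 3 → ℝ)} (hS : MeasurableSet S) :
    Measurable fun y : ℝ => volume {p : ℝ × ℝ | (![p.1, p.2, y] : Fin 3 → ℝ) ∈ S} := by
  set Θ := MeasurableEquiv.piFinSuccAbove (fun _ : Fin 3 => ℝ) 2 with hΘ
  have hT : MeasurableSet (Θ.symm ⁻¹' S) := hS.preimage Θ.symm.measurable
  have h2 : MeasurePreserving (MeasurableEquiv.finTwoArrow (α := ℝ)).symm :=
    (volume_preserving_finTwoArrow ℝ).symm
  have heq : (fun y : ℝ => volume {p : ℝ × ℝ | (![p.1, p.2, y] : Fin 3 → ℝ) ∈ S}) =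
      fun y : ℝ => volume (Prod.mk y ⁻¹' (Θ.symm ⁻¹' S)) := by
    funext y
    rw [slice3_eq_preimage]
    exact h2.measure_preimage ((hT.preimage measurable_prodMk_left).nullMeasurableSet)
  rw [heq]
  exact measurable_measure_prodMk_left hT

/-- Sections of a dilate: `{p | (p.1,p.2,u) ∈ r • S} = r • {p | (p.1,p.2,r⁻¹u) ∈ S}` (`r ≠ 0`). -/
theorem slice3_smul {r : ℝ} (hr : r ≠ 0) (S : Set (Fin 3 → ℝ)) (u : ℝ) :
    {p : ℝ × ℝ | (![p.1, p.2, u] : Fin 3 → ℝ) ∈ r • S} =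
      r • {p : ℝ × ℝ | (![p.1, p.2, r⁻¹ * u] : Fin 3 → ℝ) ∈ S} := by
  ext p
  rw [mem_setOf_eq, Set.mem_smul_set_iff_inv_smul_mem₀ hr, Set.mem_smul_set_iff_inv_smul_mem₀ hr,
    mem_setOf_eq]
  have : r⁻¹ • (![p.1, p.2, u] : Fin 3 → ℝ) = ![(r⁻¹ • p).1, (r⁻¹ • p).2, r⁻¹ * u] := by
    ext i; fin_cases i <;> simp [smul_eq_mul]
  rw [this]

/-- Volume of a dilate in `Fin 3 → ℝ`: `|r • S| = |r|³ |S|`. -/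
theorem volume_smul_fin3 (r : ℝ) (S : Set (Fin 3 → ℝ)) :
    volume (r • S) = ENNReal.ofReal (|r| ^ 3) * volume S := by
  rw [Measure.addHaar_smul, Module.finrank_fin_fun, abs_pow]

/-- Volume of a dilate in `ℝ × ℝ`: `|r • S| = |r|² |S|`. -/
theorem volume_smul_real2 (r : ℝ) (S : Set (ℝ × ℝ)) :
    volume (r • S) = ENNReal.ofReal (|r| ^ 2) * volume S := by
  rw [Measure.volume_eq_prod, Measure.addHaar_smul, Module.finrank_prod, Module.finrank_self, abs_pow]

/-! ### Chimera Brunn–Minkowski in `Fin 3 → ℝ` -/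

/-- **Chimera Brunn–Minkowski, multiplicative form** (`Fin 3 → ℝ`, height = last coordinate): if the
sections of the height-indexed bodies `W t` dominate those of `W₀` and `C` contains every
`(1−s)a + s w`, `a ∈ A`, `w ∈ W(a₂)`, then `|A|^{1−s}|W₀|^s ≤ |C|`. -/
theorem chimera3_volume_rpow_mul_le {s : ℝ} (hs0 : 0 < s) (hs1 : s < 1)
    {A C W₀ : Set (Fin 3 → ℝ)} (W : ℝ → Set (Fin 3 → ℝ))
    (hA : MeasurableSet A) (hC : MeasurableSet C) (hW₀ : MeasurableSet W₀)
    (hW : ∀ t, MeasurableSet (W t))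
    (hdom : ∀ t u, volume {p : ℝ × ℝ | (![p.1, p.2, u] : Fin 3 → ℝ) ∈ W₀} ≤
      volume {p : ℝ × ℝ | (![p.1, p.2, u] : Fin 3 → ℝ) ∈ W t})
    (hsub : ∀ a ∈ A, ∀ w ∈ W (a 2), (1 - s) • a + s • w ∈ C) :
    volume A ^ (1 - s) * volume W₀ ^ s ≤ volume C := by
  set φ : ℝ → ℝ≥0∞ := fun t => volume {p : ℝ × ℝ | (![p.1, p.2, t] : Fin 3 → ℝ) ∈ A} with hφ
  set ψ : ℝ → ℝ≥0∞ := fun u => volume {p : ℝ × ℝ | (![p.1, p.2, u] : Fin 3 → ℝ) ∈ W₀} with hψ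
  set h : ℝ → ℝ≥0∞ := fun z => volume {p : ℝ × ℝ | (![p.1, p.2, z] : Fin 3 → ℝ) ∈ C} with hh
  have key : ∀ t u, φ t ^ (1 - s) * ψ u ^ s ≤ h ((1 - s) • t + s • u) := by
    intro t u
    have hincl : (1 - s) • {p : ℝ × ℝ | (![p.1, p.2, t] : Fin 3 → ℝ) ∈ A} +
        s • {p : ℝ × ℝ | (![p.1, p.2, u] : Fin 3 → ℝ) ∈ W t} ⊆
        {p : ℝ × ℝ | (![p.1, p.2, (1 - s) • t + s • u] : Fin 3 → ℝ) ∈ C} := by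
      intro x hx
      obtain ⟨_, ⟨p, hp, rfl⟩, _, ⟨q, hq, rfl⟩, rfl⟩ := hx
      have hq' : (![q.1, q.2, u] : Fin 3 → ℝ) ∈ W ((![p.1, p.2, t] : Fin 3 → ℝ) 2) := by
        simpa using hq
      have h1 := hsub _ hp _ hq'
      have e : (1 - s) • (![p.1, p.2, t] : Fin 3 → ℝ) + s • (![q.1, q.2, u] : Fin 3 → ℝ) =
          ![((1 - s) • p + s • q).1, ((1 - s) • p + s • q).2, (1 - s) • t + s • u] := by
        ext i; fin_cases i <;> simp [smul_eq_mul]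
      rw [e] at h1
      exact h1
    have h2 := volume_rpow_mul_volume_rpow_le_real2 hs0 hs1 (measurableSet_slice3 hA t)
      (measurableSet_slice3 (hW t) u) (measurableSet_slice3 hC _) hincl
    calc φ t ^ (1 - s) * ψ u ^ s
        ≤ volume {p : ℝ × ℝ | (![p.1, p.2, t] : Fin 3 → ℝ) ∈ A} ^ (1 - s) *
            volume {p : ℝ × ℝ | (![p.1, p.2, u] : Fin 3 → ℝ) ∈ W t} ^ s := by
          gcongr
          exact hdom t u
      _ ≤ h ((1 - s) • t + s • u) := h2
  have pl := prekopaLeindler_real hs0 hs1 (measurable_volume_slice3 hA)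
    (measurable_volume_slice3 hW₀) (measurable_volume_slice3 hC) key
  rw [volume_eq_lintegral_slice3 A hA, volume_eq_lintegral_slice3 W₀ hW₀, volume_eq_lintegral_slice3 C hC]
  exact pl

/-- **Chimera Brunn–Minkowski, additive (homogeneous) form** (`Fin 3 → ℝ`): with
`C ⊇ {a + w | a ∈ A, w ∈ W(a₂)}`, `a³ ≤ |A|`, `b³ ≤ |W₀|` (`a, b > 0`): `(a + b)³ ≤ |C|`. -/
theorem chimera3_brunnMinkowski_pow
    {A C W₀ : Set (Fin 3 → ℝ)} (W : ℝ → Set (Fin 3 → ℝ))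
    (hA : MeasurableSet A) (hC : MeasurableSet C) (hW₀ : MeasurableSet W₀)
    (hW : ∀ t, MeasurableSet (W t))
    (hdom : ∀ t u, volume {p : ℝ × ℝ | (![p.1, p.2, u] : Fin 3 → ℝ) ∈ W₀} ≤
      volume {p : ℝ × ℝ | (![p.1, p.2, u] : Fin 3 → ℝ) ∈ W t})
    (hsub : ∀ a ∈ A, ∀ w ∈ W (a 2), a + w ∈ C)
    {a b : ℝ} (ha : 0 < a) (hb : 0 < b) (hvA : ENNReal.ofReal (a ^ 3) ≤ volume A)
    (hvB : ENNReal.ofReal (b ^ 3) ≤ volume W₀) :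
    ENNReal.ofReal ((a + b) ^ 3) ≤ volume C := by
  have hab : 0 < a + b := add_pos ha hb
  set s : ℝ := b / (a + b) with hs
  have hs0 : 0 < s := div_pos hb hab
  have hs1 : s < 1 := (div_lt_one hab).2 (by linarith)
  have h1s : 1 - s = a / (a + b) := by rw [hs]; field_simp; ring
  have hvA' : 1 ≤ volume (a⁻¹ • A) := by
    rw [volume_smul_fin3, abs_of_pos (inv_pos.2 ha)]
    calc (1 : ℝ≥0∞) = ENNReal.ofReal (a⁻¹ ^ 3) * ENNReal.ofReal (a ^ 3) := by
          rw [← ENNReal.ofReal_mul (pow_nonneg (inv_pos.2 ha).le _), ← mul_pow,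
            inv_mul_cancel₀ ha.ne', one_pow, ENNReal.ofReal_one]
      _ ≤ ENNReal.ofReal (a⁻¹ ^ 3) * volume A := by gcongr
  have hvB' : 1 ≤ volume (b⁻¹ • W₀) := by
    rw [volume_smul_fin3, abs_of_pos (inv_pos.2 hb)]
    calc (1 : ℝ≥0∞) = ENNReal.ofReal (b⁻¹ ^ 3) * ENNReal.ofReal (b ^ 3) := by
          rw [← ENNReal.ofReal_mul (pow_nonneg (inv_pos.2 hb).le _), ← mul_pow,
            inv_mul_cancel₀ hb.ne', one_pow, ENNReal.ofReal_one]
      _ ≤ ENNReal.ofReal (b⁻¹ ^ 3) * volume W₀ := by gcongr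
  have hdom' : ∀ t u, volume {p : ℝ × ℝ | (![p.1, p.2, u] : Fin 3 → ℝ) ∈ b⁻¹ • W₀} ≤
      volume {p : ℝ × ℝ | (![p.1, p.2, u] : Fin 3 → ℝ) ∈ b⁻¹ • W (a * t)} := by
    intro t u
    rw [slice3_smul (inv_ne_zero hb.ne'), slice3_smul (inv_ne_zero hb.ne'), volume_smul_real2,
      volume_smul_real2]
    exact mul_le_mul' le_rfl (hdom _ _)
  have hsub' : ∀ a' ∈ a⁻¹ • A, ∀ w' ∈ (fun t => b⁻¹ • W (a * t)) (a' 2),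
      (1 - s) • a' + s • w' ∈ (a + b)⁻¹ • C := by
    intro a' ha' w' hw'
    obtain ⟨x, hx, rfl⟩ := Set.mem_smul_set.1 ha'
    obtain ⟨y, hy, rfl⟩ := Set.mem_smul_set.1 hw'
    have hxy : x + y ∈ C := by
      refine hsub x hx y ?_
      have e : a * (a⁻¹ • x) 2 = x 2 := by
        rw [Pi.smul_apply, smul_eq_mul, ← mul_assoc, mul_inv_cancel₀ ha.ne', one_mul]
      rwa [e] at hy
    refine Set.mem_smul_set.2 ⟨x + y, hxy, ?_⟩
    rw [h1s, hs, smul_smul, smul_smul, div_mul_eq_mul_div, mul_inv_cancel₀ ha.ne',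
      div_mul_eq_mul_div, mul_inv_cancel₀ hb.ne', one_div, smul_add]
  have hmult := chimera3_volume_rpow_mul_le hs0 hs1 (fun t => b⁻¹ • W (a * t))
    (hA.const_smul₀ a⁻¹) (hC.const_smul₀ (a + b)⁻¹) (hW₀.const_smul₀ b⁻¹)
    (fun t => (hW (a * t)).const_smul₀ b⁻¹) hdom' hsub'
  have hone : (1 : ℝ≥0∞) ≤ volume ((a + b)⁻¹ • C) := by
    calc (1 : ℝ≥0∞) = 1 ^ (1 - s) * 1 ^ s := by rw [ENNReal.one_rpow, ENNReal.one_rpow, one_mul]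
      _ ≤ volume (a⁻¹ • A) ^ (1 - s) * volume (b⁻¹ • W₀) ^ s :=
          mul_le_mul' (ENNReal.rpow_le_rpow hvA' (by linarith)) (ENNReal.rpow_le_rpow hvB' hs0.le)
      _ ≤ volume ((a + b)⁻¹ • C) := hmult
  rw [volume_smul_fin3, abs_of_pos (inv_pos.2 hab)] at hone
  calc ENNReal.ofReal ((a + b) ^ 3) = ENNReal.ofReal ((a + b) ^ 3) * 1 := (mul_one _).symm
    _ ≤ ENNReal.ofReal ((a + b) ^ 3) * (ENNReal.ofReal ((a + b)⁻¹ ^ 3) * volume C) := by gcongr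
    _ = volume C := by
        rw [← mul_assoc, ← ENNReal.ofReal_mul (pow_nonneg hab.le _), ← mul_pow,
          mul_inv_cancel₀ hab.ne', one_pow, ENNReal.ofReal_one, one_mul]

/-- **Chimera Brunn–Minkowski, root form** (`Fin 3 → ℝ`): `|A|^{1/3} + |W₀|^{1/3} ≤ |C|^{1/3}` for
`0 < |A| < ∞`, `0 < |W₀| < ∞`. -/
theorem chimera3_brunnMinkowski
    {A C W₀ : Set (Fin 3 → ℝ)} (W : ℝ → Set (Fin 3 → ℝ))
    (hA : MeasurableSet A) (hC : MeasurableSet C) (hW₀ : MeasurableSet W₀)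
    (hW : ∀ t, MeasurableSet (W t))
    (hdom : ∀ t u, volume {p : ℝ × ℝ | (![p.1, p.2, u] : Fin 3 → ℝ) ∈ W₀} ≤
      volume {p : ℝ × ℝ | (![p.1, p.2, u] : Fin 3 → ℝ) ∈ W t})
    (hsub : ∀ a ∈ A, ∀ w ∈ W (a 2), a + w ∈ C)
    (hA0 : volume A ≠ 0) (hAt : volume A ≠ ⊤) (hB0 : volume W₀ ≠ 0) (hBt : volume W₀ ≠ ⊤) :
    volume A ^ ((3 : ℕ)⁻¹ : ℝ) + volume W₀ ^ ((3 : ℕ)⁻¹ : ℝ) ≤ volume C ^ ((3 : ℕ)⁻¹ : ℝ) := by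
  have hn : (3 : ℕ) ≠ 0 := by norm_num
  have hn0 : (0 : ℝ) < ((3 : ℕ)⁻¹ : ℝ) := by positivity
  set a : ℝ := (volume A).toReal ^ ((3 : ℕ)⁻¹ : ℝ) with ha_def
  set b : ℝ := (volume W₀).toReal ^ ((3 : ℕ)⁻¹ : ℝ) with hb_def
  have ha : 0 < a := Real.rpow_pos_of_pos (ENNReal.toReal_pos hA0 hAt) _
  have hb : 0 < b := Real.rpow_pos_of_pos (ENNReal.toReal_pos hB0 hBt) _
  have han : ENNReal.ofReal (a ^ 3) = volume A := by
    rw [ha_def, Real.rpow_inv_natCast_pow ENNReal.toReal_nonneg hn, ENNReal.ofReal_toReal hAt]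
  have hbn : ENNReal.ofReal (b ^ 3) = volume W₀ := by
    rw [hb_def, Real.rpow_inv_natCast_pow ENNReal.toReal_nonneg hn, ENNReal.ofReal_toReal hBt]
  have hpow := chimera3_brunnMinkowski_pow W hA hC hW₀ hW hdom hsub ha hb han.le hbn.le
  have hroot := ENNReal.rpow_le_rpow hpow hn0.le
  rw [ENNReal.ofReal_rpow_of_nonneg (pow_nonneg (add_nonneg ha.le hb.le) _) hn0.le,
    Real.pow_rpow_inv_natCast (add_nonneg ha.le hb.le) hn, ENNReal.ofReal_add ha.le hb.le] at hroot
  have hA' : ENNReal.ofReal a = volume A ^ ((3 : ℕ)⁻¹ : ℝ) := by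
    rw [ha_def, ← ENNReal.ofReal_rpow_of_nonneg ENNReal.toReal_nonneg hn0.le,
      ENNReal.ofReal_toReal hAt]
  have hB' : ENNReal.ofReal b = volume W₀ ^ ((3 : ℕ)⁻¹ : ℝ) := by
    rw [hb_def, ← ENNReal.ofReal_rpow_of_nonneg ENNReal.toReal_nonneg hn0.le,
      ENNReal.ofReal_toReal hBt]
  rwa [hA', hB'] at hroot

/-! ### The stacking Wulff bodies -/

/-- **Every layered profile's chimera neighbourhood beats the fcc one.**  For every height profile
`f : ℝ → [0,1]`, every measurable `A ⊆ ℝ³` of positive finite volume and every `r > 0`: if `C` is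
measurable and contains `a + r•w` for all `a ∈ A`, `w ∈ W_{f(a₂)}` (the stacking Wulff body of the
letter density AT THE HEIGHT OF `a`), then `|A|^{1/3} + r·|W_0|^{1/3} ≤ |C|^{1/3}`
(`|W_0| = 64√2`, `volume_stackWulff_zero`).  Ingredient beyond Brunn–Minkowski: the landed
`stub_sliceDomination` (`|stackSlice 0 y| ≤ |stackSlice f y|`). -/
theorem chimera_stackWulff {f : ℝ → ℝ} (hf : ∀ t, 0 ≤ f t ∧ f t ≤ 1)
    {A C : Set (Fin 3 → ℝ)} (hA : MeasurableSet A) (hC : MeasurableSet C) {r : ℝ} (hr : 0 < r)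
    (hsub : ∀ a ∈ A, ∀ w ∈ stackWulff (f (a 2)), a + r • w ∈ C)
    (hA0 : volume A ≠ 0) (hAt : volume A ≠ ⊤) :
    volume A ^ ((3 : ℕ)⁻¹ : ℝ) + ENNReal.ofReal r * volume (stackWulff 0) ^ ((3 : ℕ)⁻¹ : ℝ) ≤
      volume C ^ ((3 : ℕ)⁻¹ : ℝ) := by
  have hn0 : (0 : ℝ) ≤ ((3 : ℕ)⁻¹ : ℝ) := by positivity
  -- the dilated reference body and its volume
  have hV0 : volume (r • stackWulff 0) = ENNReal.ofReal (r ^ 3) * volume (stackWulff 0) := by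
    rw [volume_smul_fin3, abs_of_pos hr]
  have hW0pos : volume (stackWulff 0) ≠ 0 := by
    rw [volume_stackWulff_zero]; exact (ENNReal.ofReal_pos.2 (by positivity)).ne'
  have hW0top : volume (stackWulff 0) ≠ ⊤ := by rw [volume_stackWulff_zero]; exact ENNReal.ofReal_ne_top
  have hB0 : volume (r • stackWulff 0) ≠ 0 := by
    rw [hV0]; exact mul_ne_zero (ENNReal.ofReal_pos.2 (by positivity)).ne' hW0pos
  have hBt : volume (r • stackWulff 0) ≠ ⊤ := by
    rw [hV0]; exact ENNReal.mul_ne_top ENNReal.ofReal_ne_top hW0top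
  -- slice domination for the dilated, height-indexed family
  have hdom : ∀ t u, volume {p : ℝ × ℝ | (![p.1, p.2, u] : Fin 3 → ℝ) ∈ r • stackWulff 0} ≤
      volume {p : ℝ × ℝ | (![p.1, p.2, u] : Fin 3 → ℝ) ∈ r • stackWulff (f t)} := by
    intro t u
    rw [slice3_smul hr.ne', slice3_smul hr.ne', volume_smul_real2, volume_smul_real2]
    exact mul_le_mul' le_rfl (stub_sliceDomination (f t) (hf t).1 (hf t).2 (r⁻¹ * u))
  have hsub' : ∀ a ∈ A, ∀ w ∈ (fun t => r • stackWulff (f t)) (a 2), a + w ∈ C := by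
    intro a ha w hw
    obtain ⟨w₀, hw₀, rfl⟩ := Set.mem_smul_set.1 hw
    exact hsub a ha w₀ hw₀
  have h := chimera3_brunnMinkowski (fun t => r • stackWulff (f t)) hA hC
    ((measurableSet_stackWulff 0).const_smul₀ r) (fun t => (measurableSet_stackWulff (f t)).const_smul₀ r)
    hdom hsub' hA0 hAt hB0 hBt
  have e : volume (r • stackWulff 0) ^ ((3 : ℕ)⁻¹ : ℝ) =
      ENNReal.ofReal r * volume (stackWulff 0) ^ ((3 : ℕ)⁻¹ : ℝ) := by
    rw [hV0, ENNReal.mul_rpow_of_nonneg _ _ hn0, ENNReal.ofReal_rpow_of_nonneg (by positivity) hn0,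
      Real.pow_rpow_inv_natCast hr.le (by norm_num)]
  rwa [e] at h

end Summit.Ventures.Crystal3D.Theorems.Chimera

end
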